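import Mathlib
import Literature.MathematicalPhysics.QuantumFieldTheory.Balaban1983to89.B12Decay510
import Literature.Probability.LatticeModels.PolymerGasGeometric

/-!
# B12 §4 p.290, display (4.36) — the extension of the sum over localization domains to the whole
class 𝐃⁰_j of the infinite lattice, and the absolute convergence of (4.37): the polymer-sum mechanism
ON AN INFINITE CLASS OF DOMAINS

[cite: Balaban1987RG1 = T. Bałaban, *Renormalization group approach to lattice gauge field theories. I. Generation of
effective actions in a small field approximation and a coupling constant renormalization in four dimensions*,
Commun. Math. Phys. **109** (1987) 249–301; PDF page = journal page − 248.]  Companion modules (imported, none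
modified): `…Balaban1983to89.B12TreeDecay` (unit pv03: (1.26) for a FINITE system of domains from the volume leaf,
constants `a₀`, `kappa₀`, `K₀`), `…Balaban1983to89.B12Decay510` (unit b03 gen 3: (5.10) on a FINITE system from named
leaves, printed `delta1 δ₀ κ M = ½ min{δ₀, κM⁻¹}`), `Literature.Probability.LatticeModels.PolymerGasGeometric`
(`sum_pow_card_le_of_connected`: the lattice-animal count through a cell, for an ARBITRARY cell type).

## CITATION HEADER (verbatim; journal p.290 = render `…1987-cmp109-rg-I-small-field-p042-x2.png`, p.271 = `…-p023-x2.png`,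
p.257 = `…-p009-x2.png`, all read as images)

p.290, the paragraph before (4.36): «Finally, the crucial step is an extension of the sum over localization domains X.
In this section we consider the expressions with the localization domains X satisfying the condition X ⊂ □̃², for a
given cube □. The expressions with localization domains, which do not satisfy this condition, are exponentially small
in L^jη, either because the domains are large, or because their distances to □ are large. We have analyzed it in
Sect. 3. Of course we have the sum over all X ∈ 𝐃_j in (3.7), the sum connected with the representation (1.7) of
𝐄^{(j)}. This sum was divided into two subsums for a given □, and in this section we consider this subsum for which
X ∈ 𝐃_j, X ⊂ □̃². We extend it to all X ∈ 𝐃⁰_j, where 𝐃⁰_j is the class of localization domains constructed for the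
lattice ξZ⁴. More exactly we make this extension for all explicitly written terms in (3.34), not for irrelevant
terms. This means that we sum the function 𝐄^{(2)}(X) over X ∈ 𝐃⁰_j, because the other expressions do not depend on
X. The difference between the two sums gives a function satisfying the following inequality

  (4.36)  ∣Σ_{X∈𝐃⁰_j, X∩(□̃²)ᶜ≠∅} 𝐄^{(2)}_{μ,ν}(X, x, y)∣ ≤ O(1)E₀ exp(−(L^jη)^{−1}) exp(−δ₁∣x − y∣),  for x ∈ □,

hence, substituting it into (4.34), we get an irrelevant expression again.»  p.291: «(4.37) Π_{μ,ν}(x, y) =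
Σ_{X∈𝐃⁰_j} 𝐄^{(2)}_{μ,ν}(X, x, y)».

p.271 («We have analyzed it in Sect. 3»), verbatim: «The division is according to the conditions  X∩(□̃²)ᶜ ≠ ∅, or
X ⊂ □̃². (3.5)  Consider a domain X satisfying the first condition above. Assume that X ∈ 𝐃_j. There are two cases
possible, either X∩□̃ = ∅, or X∩□̃ ≠ ∅. In the first case dist(X, □) ≥ M, the distance is in the scale η, hence in the
scale ξ dist^{(ξ)}(X, □) ≥ M(L^jη)^{−1}. In the second case X is a big domain in ξ-scale, for example d_j(X) ≥
(L^jη)^{−1}. Thus either the exponential decay of propagators corresponding to ξ-scale, or the exponential bound (1.18)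
should give a small factor O((L^jη)^N) with an arbitrary power N, enough to control the sums.»; (3.9) p.271 prints the
half-rate split «∣δ𝐇_j∣ ≤ B₃ exp(−½δ₀dist^{(ξ)}(X, □) − ½δ₀M(L^jη)^{−1}) …».

p.257: «Such a domain is a union of a connected, finite family of cubes from π_j. … The class of all these
localization domains is denoted by 𝐃_j. … A length of a shortest graph in this class, divided by M, is the linear
size of X, and is denoted by d_j(X).»; (1.18) p.263: «∣𝐄^{(j)}(X, g_{j−1}, 𝐔, 𝐉)∣ ≤ E_0 exp(−κd_j(X))» (the
bound (0.25) p.257 of the introduction); (0.26) p.257 and [II] =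
[cite: Balaban1988RG2Cluster] (1.26) p.8: «Σ_{X∈𝐃_j, X⊃□′} exp(−κd_j(X)) ≤ O(1), (1.26) for κ sufficiently large.»

## WHAT IS TYPED HERE (the MECHANISM, as [folklore] analysis over an abstract class of domains; nothing of B12's
analysis is asserted — every analytic input is a NAMED hypothesis with its printed address)

𝐃⁰_j is an INFINITE class (the cubes π_j of ξZ⁴ are countably many), whereas `B12TreeDecay` / `B12Decay510` quantify
over a `Fintype` of domains.  §1 `DomainClass`: an arbitrary (possibly infinite) type of cubes with a symmetric
wall-adjacency of degree ≤ Δ, an arbitrary type of domains, each a nonempty finite wall-connected family of cubes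
(injectively), and the tree length d_j ≥ 0 (abstract, cell DIVERGENCE F5).  §2 (1.26) ON THE INFINITE CLASS, typed as
a bound UNIFORM OVER FINITE SUBFAMILIES through a cube (`Ineq126`; for non-negative terms this is exactly «the sum ≤
O(1)»: `summable_above`) and PROVED from the volume leaf ∣X∣ ≤ c₀(1 + d_j(X)) ([cite: Dimock2013BalabanII] App. E Lemma
E.1) and the degree bound, with `B12TreeDecay`'s constants: `ineq126_of_volumeLeaf` (κ ≥ κ₀(c₀, Δ) ⇒ bound K₀(c₀, Δ)).
§3 the site geometry and the leaves of `B12Decay510` re-typed over the infinite class (`GeomLeaf`, `CubeSumLeaf` as a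
uniform finite-family bound, `KernelBound` = ∣𝐄²(X, x, y)∣ ≤ C_E e^{−κd_j(X)}e^{−δ₀dist(x,X)}e^{−δ₀dist(y,X)}, the
content of (1.18) + (4.3)–(4.5) p.282) and the ONE new leaf of (4.36), `FarLeaf`: for x ∈ □ and X∩(□̃²)ᶜ ≠ ∅,
R ≤ dist(x, X) + M·d_j(X) — the two cases of p.271 in one inequality (R = M(L^jη)^{−1} in the units of `B12Decay510`:
sites of the unit lattice, cubes of side M; R is a FREE parameter here).  §4 the engine: with the exponent budget
δ₁M + θM + κ′ ≤ κ, δ₁ + θ + a′ ≤ δ₀ (δ₁ pays for e^{−δ₁∣x−y∣}, θ for the smallness e^{−θR}, κ′ for the domain count, a′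
for the cube sum), every FINITE partial sum obeys Σ_{X∈F}∣𝐄²(X, x, y)∣ ≤ C_E e^{δ₁Mc₁}K₀K₁ · e^{−θR} · e^{−δ₁ρ(x,y)}
(`sum_abs_le_of_far`).  §5 hence (4.36): the family X ↦ 𝐄²(X, x, y) over {X ∈ 𝐃⁰_j : X∩(□̃²)ᶜ ≠ ∅} is SUMMABLE and
its sum obeys the same bound (`ineq436`); with θ = 0, (4.37) converges absolutely and ∣Π(x, y)∣ ≤ C_E e^{δ₁Mc₁}K₀K₁
e^{−δ₁ρ(x,y)} DIRECTLY on the infinite class (`twoPoint_summable`, no torus limit; `decay510_of_twoPoint` lands it in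
the lineage's `B12Sec2to5.Decay510`).  §6 the printed constants: δ₁ = `delta1 δ₀ κ M` = ½ min{δ₀, κM⁻¹}, θ = δ₁/2,
κ′ = κ/4, a′ = δ₀/4 satisfy the budget (`budget_delta1`); `ineq436_delta1`, `ineq436_printed` (the factor
exp(−(L^jη)^{−1}) = e^{−T} whenever T ≤ θR), `ineq436_of_volumeLeaf` (the domain count discharged: κ ≥ 4κ₀(c₀, Δ)),
`twoPoint_delta1` ((5.10) on 𝐃⁰_j with the leaves of `B12Decay510` at κ/2, δ₀/2).  §7 dictionary: a finite
`B12TreeDecay.CubeSystem` IS a `DomainClass` (`ofCubeSystem`), on it `Ineq126` ⟺ `Ineq126Printed`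
(`ineq126_iff_printed`), a `B12Decay510.SiteGeometry` is a `SiteGeometry` (`SiteGeometry.ofFinite`), and
`B12Decay510.sum_abs_le` is recovered (`sum_abs_le_ofFinite`, for M ≥ 0) — the infinite typing is a conservative
extension of the finite one.

## DICTIONARY / DIVERGENCE (recorded in the cell file)

(i) 𝐃⁰_j ↦ `DomainClass` (abstract cubes/adjacency/tree length; the cube geometry of ξZ⁴ is not constructed, F5).
(ii) «X∩(□̃²)ᶜ ≠ ∅», «x ∈ □» ↦ abstract predicates `Far`, `Box` tied ONLY by `FarLeaf` (R ≤ dist(x, X) + M d_j(X));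
the two printed cases give R = M(L^jη)^{−1}; which lattice norm dist^{(ξ)} is, and the cubes □̃, □̃², are not typed.
(iii) «O(1)E₀ exp(−(L^jη)^{−1})» ↦ C_E e^{δ₁Mc₁}K₀K₁ · e^{−θR} with θ = δ₁/2 = ¼ min{δ₀, κM⁻¹}; the literal factor
exp(−(L^jη)^{−1}) is e^{−T} under T ≤ θR, i.e. for R = M·T under min{δ₀M, κ} ≥ 4 — a largeness condition on (M, κ) of
the kind the series imposes («for κ sufficiently large», M = L^m) but does not display at (4.36); C_E = 4E₀α₂⁻²B₃² when
the kernel bound is derived from (4.35) as in `B12Decay510.kernelBound_of_repr435` (not re-derived here).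
(iv) δ₁ in (4.36) is read as the δ₁ of (5.10) p.293 («e.g., δ₁ = 1/2min{δ₀, κM⁻¹}»); print introduces δ₁ only there.
(v) The domain count is used at rate κ/4 (budget), so the discharged form needs κ ≥ 4κ₀(c₀, Δ) where `B12Decay510`
needs κ ≥ 2κ₀; print: «for κ sufficiently large».

## NOT TYPED / NOT CLAIMED

That the terms of (1.7) are defined for domains of the infinite lattice (the structural hypothesis behind «constructed
for the lattice ξZ⁴»); the kernel bound itself ((1.18), (4.5), [15]); the geometry of π_j, □̃ⁿ, ζ_□; «substituting it
into (4.34), we get an irrelevant expression again» (the L^jη bookkeeping of irrelevant terms).  This module is a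
kernel certificate of an elementary mechanism, NOT progress on any summit statement.
-/

namespace Literature.MathematicalPhysics.QuantumFieldTheory.Balaban1983to89.B12Ext436

open Literature.MathematicalPhysics.QuantumFieldTheory.Balaban1983to89
open Literature.Probability.LatticeModels (IsRConnected sum_pow_card_le_of_connected)
open Literature.MathematicalPhysics.QuantumFieldTheory.Balaban1983to89.B12TreeDecay
  (a₀ kappa₀ K₀ a₀_nonneg exp_neg_a₀ smallness_a₀ kappa₀_nonneg K₀_pos)
open Literature.MathematicalPhysics.QuantumFieldTheory.Balaban1983to89.B12Decay510
  (delta1 delta1_le_half delta1_mul_le delta1_nonneg delta1_pos)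
open Literature.MathematicalPhysics.QuantumFieldTheory.Balaban1983to89.B12Sec2to5 (l1 Decay510)

/-! ## 0. Two summation tools: uniform bounds on finite partial sums ⇒ summability and the bound on the sum -/

/-- Non-negative family with uniformly bounded finite partial sums: summable, and the sum obeys the bound
(Mathlib's `summable_of_sum_le` + `Summable.tsum_le_of_sum_le`). [folklore] -/
theorem summable_and_tsum_le_of_sum_le {ι : Type*} {f : ι → ℝ} {B : ℝ} (hf : ∀ i, 0 ≤ f i)
    (h : ∀ u : Finset ι, ∑ i ∈ u, f i ≤ B) : Summable f ∧ ∑' i, f i ≤ B :=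
  have hs : Summable f := summable_of_sum_le (fun i => hf i) h
  ⟨hs, hs.tsum_le_of_sum_le h⟩

/-- Real family whose absolute values have uniformly bounded finite partial sums: (absolutely) summable, and
∣Σ′ f∣ ≤ the bound. [folklore] -/
theorem summable_and_abs_tsum_le_of_sum_abs_le {ι : Type*} (f : ι → ℝ) {B : ℝ}
    (h : ∀ u : Finset ι, ∑ i ∈ u, |f i| ≤ B) : Summable f ∧ |∑' i, f i| ≤ B := by
  obtain ⟨hs, ht⟩ := summable_and_tsum_le_of_sum_le (fun i => abs_nonneg (f i)) h
  refine ⟨hs.of_abs, ?_⟩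
  have h1 : ‖∑' i, f i‖ ≤ ∑' i, ‖f i‖ :=
    norm_tsum_le_tsum_norm (by simpa only [Real.norm_eq_abs] using hs)
  simp only [Real.norm_eq_abs] at h1
  exact h1.trans ht

/-! ## 1. The class 𝐃⁰_j of localization domains of an infinite lattice -/

/-- **The class 𝐃⁰_j** (p. 290: *"𝐃⁰_j is the class of localization domains constructed for the lattice ξZ⁴"*; p. 257:
*"Such a domain is a union of a connected, finite family of cubes from π_j … A connected family means that for every
pair □, □′ of cubes from the family there exists a sequence □, □₁, …, □_n, □′ of cubes belonging to the family and such
that two consecutive cubes have a common wall"*): an ARBITRARY (here: possibly infinite) type of cubes with the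
symmetric wall-adjacency and finite neighbour lists, an arbitrary type of domains, the finite family of cubes of each
domain (injective: a domain IS the union of its cubes; nonempty and chain-connected: `IsRConnected`), and the tree length
d_j ≥ 0 (*"A length of a shortest graph in this class, divided by M"*), abstract (cell DIVERGENCE F5).  The finite
`B12TreeDecay.CubeSystem` is the special case of a finite lattice (`ofCubeSystem`, §7). [cite: Balaban1987RG1, §0 p.257 and §4 p.290] -/
structure DomainClass where
  /-- the cubes `□ ∈ π_j` of the infinite lattice -/
  Cube : Type
  [deq : DecidableEq Cube]
  /-- "two … cubes have a common wall" -/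
  Adj : Cube → Cube → Prop
  adj_symm : ∀ a b, Adj a b → Adj b a
  /-- the wall-neighbours of a cube, as a finite list -/
  nbr : Cube → Finset Cube
  mem_nbr : ∀ a b, Adj a b → b ∈ nbr a
  /-- the localization domains `X ∈ 𝐃⁰_j` -/
  Dom : Type
  /-- the family of cubes of a localization domain -/
  cubes : Dom → Finset Cube
  cubes_injective : Function.Injective cubes
  /-- "a union of a connected, finite family of cubes" -/
  connected : ∀ X, IsRConnected Adj (cubes X)
  /-- the tree length `d_j(X)` -/
  dj : Dom → ℝ
  dj_nonneg : ∀ X, 0 ≤ dj X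

/-- Equality of cubes is decidable (cubes are indexed by their centres); exposes the field `DomainClass.deq`. [folklore] -/
instance DomainClass.instDecidableEqCube (G : DomainClass) : DecidableEq G.Cube := G.deq

namespace DomainClass

variable (G : DomainClass)

/-- `|X|_M` = the number of cubes of `π_j` in `X`. [cite: Dimock2013, §3.3 (arXiv:1108.1335v2 TeX L1341–1343)] -/
def vol (X : G.Dom) : ℕ := (G.cubes X).card

/-- Every domain has at least one cube. [folklore] -/
theorem vol_pos (X : G.Dom) : 0 < G.vol X := Finset.card_pos.2 (G.connected X).1

/-- Every domain contains some cube. [folklore] -/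
theorem exists_cube (X : G.Dom) : ∃ c, c ∈ G.cubes X := (G.connected X).1

/-- Degree bound: every cube has at most `Δ` wall-neighbours (`Δ = 2d` for the cubes of `ξZ^d`). A hypothesis on the
geometry, by name. [folklore] -/
def DegreeLE (Δ : ℕ) : Prop := ∀ a : G.Cube, (G.nbr a).card ≤ Δ

/-- **The quoted volume leaf** `|X|_M ≤ c₀(1 + d_j(X))` for every localization domain ([Dimock2013BalabanII] App. E
Lemma E.1, TeX L6790–6798: *"3. |Y|_M ≤ 4(2^d+1)(ℓ_M(Y)+1)"* with L6788 *"But we do have ℓ̃_M(Y) ≤ d_M(Y)"* and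
*"1. ℓ_M(Y) ≤ 2ℓ̃_M(Y)"*, whence c₀ = 8(2^d+1); exactly `B12TreeDecay.CubeSystem.VolumeLeaf` over the infinite class).
A hypothesis. [cite: Dimock2013BalabanII, App. E Lemma E.1 (arXiv:1212.5562v2 TeX L6790–6798)] -/
def VolumeLeaf (c₀ : ℝ) : Prop := ∀ X : G.Dom, (G.vol X : ℝ) ≤ c₀ * (1 + G.dj X)

/-- **(1.26) on the infinite class**, [II] p. 8 verbatim: *"Σ_{X∈𝐃_j, X⊃□′} exp(−κd_j(X)) ≤ O(1), (1.26) for κ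
sufficiently large"* ([I] (0.26) p. 257) — typed as the bound `K` on EVERY FINITE partial sum over domains containing
the cube □′ (for the non-negative terms e^{−κd_j(X)} this is equivalent to the bound on the infinite sum:
`summable_above`; on a finite system it is `B12TreeDecay.CubeSystem.Ineq126Printed`: `ineq126_iff_printed`).  NOT
asserted; PROVED below modulo the volume leaf. [cite: Balaban1988RG2Cluster, (1.26) p.8] -/
def Ineq126 (κ K : ℝ) : Prop :=
  ∀ (c : G.Cube) (F : Finset G.Dom), (∀ X ∈ F, c ∈ G.cubes X) → ∑ X ∈ F, Real.exp (-κ * G.dj X) ≤ K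

/-- (1.26) is monotone in κ: a bound at rate κ is a bound at every larger rate (d_j ≥ 0). [folklore] -/
theorem Ineq126.mono {G : DomainClass} {κ κ₂ K : ℝ} (h : G.Ineq126 κ K) (hκ : κ ≤ κ₂) : G.Ineq126 κ₂ K := by
  intro c F hF
  refine le_trans (Finset.sum_le_sum fun X _ => Real.exp_le_exp.2 ?_) (h c F hF)
  have hd := G.dj_nonneg X
  nlinarith

/-! ## 2. (1.26) on the infinite class, from the volume leaf (the lattice-animal count for an arbitrary cell type) -/

/-- **[Dimock2013] Lemma 25 (basic1) on the infinite class**: if every cube has at most `Δ` wall-neighbours, then for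
every `a ≥ a₀(Δ) = log(2(Δ+1)²)`, every cube □ and every FINITE family `F` of domains containing □,
`Σ_{X∈F} exp(−a|X|) ≤ (Δ+1)^{−2}` — the tree's `sum_pow_card_le_of_connected` (at most (Δ+1)^{2m} connected (m+1)-sets
through a vertex, for an ARBITRARY vertex type) applied to the injective image `X ↦ cubes X` with `λ = e^{−a₀}`; the
proof of `B12TreeDecay.sum_exp_vol_le` verbatim with `above □` replaced by `F`. [cite: Dimock2013, App. A Lemma 25(1) (arXiv:1108.1335v2 TeX L3080–3127)] -/
theorem sum_exp_vol_le {Δ : ℕ} (hΔ : G.DegreeLE Δ) {a : ℝ} (ha : a₀ Δ ≤ a) (c : G.Cube) (F : Finset G.Dom)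
    (hF : ∀ X ∈ F, c ∈ G.cubes X) :
    ∑ X ∈ F, Real.exp (-a * (G.vol X : ℝ)) ≤ 1 / ((Δ : ℝ) + 1) ^ 2 := by
  classical
  have hmono : ∀ X ∈ F, Real.exp (-a * (G.vol X : ℝ)) ≤ Real.exp (-a₀ Δ) ^ (G.cubes X).card := by
    intro X _
    rw [← Real.exp_nat_mul]
    apply Real.exp_le_exp.2
    have h0 : (0 : ℝ) ≤ (G.vol X : ℝ) := Nat.cast_nonneg _
    have : ((G.cubes X).card : ℝ) = (G.vol X : ℝ) := rfl
    rw [this]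
    nlinarith
  refine (Finset.sum_le_sum hmono).trans ?_
  have hinj : Set.InjOn G.cubes ↑F := G.cubes_injective.injOn
  rw [← Finset.sum_image (f := fun Y : Finset G.Cube => Real.exp (-a₀ Δ) ^ Y.card) hinj]
  have h := sum_pow_card_le_of_connected (R := G.Adj) (nbr := G.nbr) (Δ := Δ) G.adj_symm hΔ G.mem_nbr
    (Real.exp_nonneg _) (smallness_a₀ Δ) c (F.image G.cubes) (fun Y hY => by
      obtain ⟨X, hX, rfl⟩ := Finset.mem_image.1 hY
      exact ⟨hF X hX, G.connected X⟩)
  refine h.trans (le_of_eq ?_)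
  rw [exp_neg_a₀]
  have hpos : (0 : ℝ) < ((Δ : ℝ) + 1) ^ 2 := by positivity
  field_simp

/-- Term-wise comparison ([Dimock2013] L3128–3134): under `VolumeLeaf c₀` and `κ ≥ κ₀ = c₀a₀`,
`exp(−κ d_j(X)) ≤ e^{κ₀} · exp(−a₀|X|)` (`B12TreeDecay.exp_tree_le_exp_vol` over the infinite class). [cite: Dimock2013, App. A Lemma 25(2) proof (arXiv:1108.1335v2 TeX L3128–3136)] -/
theorem exp_tree_le_exp_vol {Δ : ℕ} {c₀ : ℝ} (hV : G.VolumeLeaf c₀) {κ : ℝ} (hκ : kappa₀ c₀ Δ ≤ κ) (X : G.Dom) :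
    Real.exp (-κ * G.dj X) ≤ Real.exp (kappa₀ c₀ Δ) * Real.exp (-a₀ Δ * (G.vol X : ℝ)) := by
  rw [← Real.exp_add]
  apply Real.exp_le_exp.2
  have hd : 0 ≤ G.dj X := G.dj_nonneg X
  have hv : (G.vol X : ℝ) ≤ c₀ * (1 + G.dj X) := hV X
  have ha : 0 ≤ a₀ Δ := a₀_nonneg Δ
  have h1 : a₀ Δ * (G.vol X : ℝ) ≤ a₀ Δ * (c₀ * (1 + G.dj X)) := mul_le_mul_of_nonneg_left hv ha
  have h2 : kappa₀ c₀ Δ * G.dj X ≤ κ * G.dj X := mul_le_mul_of_nonneg_right hκ hd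
  simp only [B12TreeDecay.kappa₀] at h2 ⊢
  nlinarith

/-- **(1.26) on the infinite class 𝐃⁰_j, kernel-checked modulo the volume leaf, with explicit constants**: if every
cube has at most `Δ` wall-neighbours and `|X| ≤ c₀(1 + d_j(X))` for all domains, then for every `κ ≥ κ₀(c₀, Δ) =
c₀ log(2(Δ+1)²)`, every cube □′ and every finite family of domains containing □′, `Σ exp(−κ d_j(X)) ≤ K₀(c₀, Δ) =
e^{κ₀}(Δ+1)^{−2}` — *"≤ O(1) for κ sufficiently large"*, the O(1) depending on the dimension only, uniformly in the
(infinite) lattice. [cite: Balaban1988RG2Cluster, (1.26) p.8] -/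
theorem ineq126_of_volumeLeaf {Δ : ℕ} (hΔ : G.DegreeLE Δ) {c₀ : ℝ} (hV : G.VolumeLeaf c₀) {κ : ℝ}
    (hκ : kappa₀ c₀ Δ ≤ κ) : G.Ineq126 κ (K₀ c₀ Δ) := by
  intro c F hF
  calc ∑ X ∈ F, Real.exp (-κ * G.dj X)
      ≤ ∑ X ∈ F, Real.exp (kappa₀ c₀ Δ) * Real.exp (-a₀ Δ * (G.vol X : ℝ)) :=
        Finset.sum_le_sum fun X _ => G.exp_tree_le_exp_vol hV hκ X
    _ = Real.exp (kappa₀ c₀ Δ) * ∑ X ∈ F, Real.exp (-a₀ Δ * (G.vol X : ℝ)) := (Finset.mul_sum _ _ _).symm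
    _ ≤ Real.exp (kappa₀ c₀ Δ) * (1 / ((Δ : ℝ) + 1) ^ 2) :=
        mul_le_mul_of_nonneg_left (G.sum_exp_vol_le hΔ le_rfl c F hF) (Real.exp_nonneg _)
    _ = K₀ c₀ Δ := by simp only [B12TreeDecay.K₀]; ring

/-- The "for κ sufficiently large … ≤ O(1)" quantifier shape of (1.26) on the infinite class, literally: under the leaf
there EXIST `κ₀` and `O1 > 0` (depending on `c₀`, `Δ` only) with the bound for all `κ ≥ κ₀`, all cubes and all finite
families through them. [cite: Balaban1988RG2Cluster, (1.26) p.8] -/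
theorem ineq126_eventually {Δ : ℕ} (hΔ : G.DegreeLE Δ) {c₀ : ℝ} (hV : G.VolumeLeaf c₀) :
    ∃ κ₀ O1 : ℝ, 0 < O1 ∧ ∀ κ, κ₀ ≤ κ → G.Ineq126 κ O1 :=
  ⟨kappa₀ c₀ Δ, K₀ c₀ Δ, K₀_pos c₀ Δ, fun _ hκ => G.ineq126_of_volumeLeaf hΔ hV hκ⟩

/-- (1.26) AS AN INFINITE SUM: under `Ineq126 κ K` the family X ↦ e^{−κd_j(X)} over {X ∈ 𝐃⁰_j : X ⊃ □} is summable
and `Σ′_{X⊃□} exp(−κd_j(X)) ≤ K` — the printed display on the infinite lattice. [cite: Balaban1988RG2Cluster, (1.26) p.8] -/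
theorem summable_above {κ K : ℝ} (h : G.Ineq126 κ K) (c : G.Cube) :
    Summable (fun X : {X : G.Dom // c ∈ G.cubes X} => Real.exp (-κ * G.dj X.1)) ∧
    ∑' X : {X : G.Dom // c ∈ G.cubes X}, Real.exp (-κ * G.dj X.1) ≤ K := by
  refine summable_and_tsum_le_of_sum_le (fun X => Real.exp_nonneg _) fun u => ?_
  have h' := h c (u.map (Function.Embedding.subtype _)) (fun X hX => by
    obtain ⟨X', _, rfl⟩ := Finset.mem_map.1 hX
    exact X'.2)
  simpa only [Finset.sum_map, Function.Embedding.coe_subtype] using h'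

end DomainClass

/-! ## 3. Sites, distances, and the leaves (those of `B12Decay510`, over the infinite class; one new leaf) -/

/-- The metric data of one scale over the infinite class (the ∞-analogue of `B12Decay510.SiteGeometry`): sites `Λ`
(the unit lattice of the ξ-scale), dist(x, □) and dist(x, X) ≥ 0, and for every site and domain a cube OF the domain at
which dist(x, X) is attained up to ≤ (dist(x, X) = min over the cubes of X for a finite union of cubes).  Abstract carrier
(cell DIVERGENCE F5). [cite: Balaban1987RG1, §0 p.257] -/
structure SiteGeometry (G : DomainClass) (Λ : Type*) where
  /-- dist(x, □) -/
  distC : Λ → G.Cube → ℝ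
  /-- dist(x, X) -/
  distD : Λ → G.Dom → ℝ
  distC_nonneg : ∀ x c, 0 ≤ distC x c
  distD_nonneg : ∀ x X, 0 ≤ distD x X
  /-- a cube of `X` nearest to `x` -/
  pick : Λ → G.Dom → G.Cube
  pick_mem : ∀ x X, pick x X ∈ G.cubes X
  distC_pick_le : ∀ x X, distC x (pick x X) ≤ distD x X

namespace SiteGeometry

variable {G : DomainClass} {Λ : Type*} (Γ : SiteGeometry G Λ)

/-- **Geometry leaf** (as `B12Decay510.GeomLeaf`; p. 257: M d_j(X) = the length of a shortest tree meeting all cubes of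
X, plus the triangle inequality): ∣x − y∣ ≤ dist(x, X) + dist(y, X) + M(d_j(X) + c₁).  A hypothesis; print does not
display it. [cite: Balaban1987RG1, §0 p.257] -/
def GeomLeaf (ρ : Λ → Λ → ℝ) (M c₁ : ℝ) : Prop :=
  ∀ X x y, ρ x y ≤ Γ.distD x X + Γ.distD y X + M * (G.dj X + c₁)

/-- **Cube-sum leaf** on the infinite lattice: Σ_{□∈B} exp(−a·dist(x, □)) ≤ K₁ for every FINITE set of cubes B,
uniformly in the site x (an elementary lattice sum for the cubes of side M of ξZ^d, a > 0).  A hypothesis; print does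
not display it. [cite: Balaban1987RG1, (5.10) p.293] -/
def CubeSumLeaf (a K₁ : ℝ) : Prop :=
  ∀ (x : Λ) (B : Finset G.Cube), ∑ c ∈ B, Real.exp (-a * Γ.distC x c) ≤ K₁

/-- **Two-sided kernel bound** for the terms of (4.36)/(4.37): ∣𝐄^{(2)}_{μν}(X, x, y)∣ ≤ C_E e^{−κd_j(X)}
e^{−δ₀dist(x,X)} e^{−δ₀dist(y,X)} — the content of (1.18) p. 263 + (4.3)–(4.5) p. 282 (*"if one of the functions B_i
is localized outside the domain X, then we have the additional exponential factor exp(−δ₀dist^{(ξ)}(X, supp B_i))"*)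
for the r = 2 term (4.35); exactly `B12Decay510.KernelBound` over the infinite class (there DERIVED from (4.35)-shaped
leaves with C_E = 4E₀α₂⁻²B₃², `kernelBound_of_repr435`).  A hypothesis. [cite: Balaban1987RG1, (4.5) p.282 and (4.35) p.290] -/
def KernelBound (E2 : G.Dom → Λ → Λ → ℝ) (CE κ δ₀ : ℝ) : Prop :=
  ∀ X x y, |E2 X x y| ≤
    CE * Real.exp (-κ * G.dj X) * Real.exp (-δ₀ * Γ.distD x X) * Real.exp (-δ₀ * Γ.distD y X)

/-- **The separation leaf of (4.36)** — p. 271, verbatim: *"Consider a domain X satisfying the first condition above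
[X∩(□̃²)ᶜ ≠ ∅]. … There are two cases possible, either X∩□̃ = ∅, or X∩□̃ ≠ ∅. In the first case dist(X, □) ≥ M, the
distance is in the scale η, hence in the scale ξ dist^{(ξ)}(X, □) ≥ M(L^jη)^{−1}. In the second case X is a big domain
in ξ-scale, for example d_j(X) ≥ (L^jη)^{−1}."* — both cases in ONE inequality: for x ∈ □ (`Box`) and X meeting
(□̃²)ᶜ (`Far`), `R ≤ dist(x, X) + M·d_j(X)` (printed: R = M(L^jη)^{−1}, sites of the unit ξ-lattice, cubes of side M).
A hypothesis on the (untyped) cube geometry; `Far`, `Box`, `R` are free. [cite: Balaban1987RG1, (3.5) p.271 and (4.36) p.290] -/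
def FarLeaf (Far : G.Dom → Prop) (Box : Set Λ) (M R : ℝ) : Prop :=
  ∀ X x, Far X → x ∈ Box → R ≤ Γ.distD x X + M * G.dj X

/-! ## 4. The engine: one term, the regrouping by the nearest cube, every finite partial sum -/

/-- The exponent bookkeeping of one term under the BUDGET δ₁M + θM + κ′ ≤ κ, δ₁ + θ + a′ ≤ δ₀ (δ₁, θ, a′ ≥ 0): with the
geometry leaf, C_E e^{−κd} e^{−δ₀dist(x,X)} e^{−δ₀dist(y,X)} ≤ C_E e^{δ₁Mc₁} e^{−δ₁∣x−y∣} · e^{−θ(dist(x,X) + Md)} ·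
e^{−κ′d} e^{−a′dist(x,□(x,X))} (δ₁ pays for the decay in ∣x − y∣, θ for the smallness, κ′ and a′ are kept for the domain
and cube sums; the second distance factor is dropped). [folklore] -/
theorem term_le {ρ : Λ → Λ → ℝ} {CE κ δ₀ δ₁ θ κ' a' M c₁ : ℝ} (hCE : 0 ≤ CE)
    (hδ₁ : 0 ≤ δ₁) (hθ : 0 ≤ θ) (ha' : 0 ≤ a') (hκb : δ₁ * M + θ * M + κ' ≤ κ) (hδb : δ₁ + θ + a' ≤ δ₀)
    (hgeo : Γ.GeomLeaf ρ M c₁) (X : G.Dom) (x y : Λ) :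
    CE * Real.exp (-κ * G.dj X) * Real.exp (-δ₀ * Γ.distD x X) * Real.exp (-δ₀ * Γ.distD y X) ≤
      CE * Real.exp (δ₁ * M * c₁) * Real.exp (-δ₁ * ρ x y) *
        Real.exp (-θ * (Γ.distD x X + M * G.dj X)) *
        (Real.exp (-κ' * G.dj X) * Real.exp (-a' * Γ.distC x (Γ.pick x X))) := by
  have hd := G.dj_nonneg X
  have ha := Γ.distD_nonneg x X
  have hb := Γ.distD_nonneg y X
  have hp := Γ.distC_pick_le x X
  have h1 : (δ₁ + θ + a') * Γ.distD x X ≤ δ₀ * Γ.distD x X := mul_le_mul_of_nonneg_right hδb ha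
  have h2 : δ₁ * Γ.distD y X ≤ δ₀ * Γ.distD y X := mul_le_mul_of_nonneg_right (by linarith) hb
  have h3 : (δ₁ * M + θ * M + κ') * G.dj X ≤ κ * G.dj X := mul_le_mul_of_nonneg_right hκb hd
  have h4 : a' * Γ.distC x (Γ.pick x X) ≤ a' * Γ.distD x X := mul_le_mul_of_nonneg_left hp ha'
  have h5 : δ₁ * ρ x y ≤ δ₁ * (Γ.distD x X + Γ.distD y X + M * (G.dj X + c₁)) :=
    mul_le_mul_of_nonneg_left (hgeo X x y) hδ₁
  have key : -κ * G.dj X + -δ₀ * Γ.distD x X + -δ₀ * Γ.distD y X ≤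
      δ₁ * M * c₁ + -δ₁ * ρ x y + -θ * (Γ.distD x X + M * G.dj X) +
        (-κ' * G.dj X + -a' * Γ.distC x (Γ.pick x X)) := by
    linarith
  calc CE * Real.exp (-κ * G.dj X) * Real.exp (-δ₀ * Γ.distD x X) * Real.exp (-δ₀ * Γ.distD y X)
      = CE * Real.exp (-κ * G.dj X + -δ₀ * Γ.distD x X + -δ₀ * Γ.distD y X) := by
        rw [Real.exp_add, Real.exp_add]; ring
    _ ≤ CE * Real.exp (δ₁ * M * c₁ + -δ₁ * ρ x y + -θ * (Γ.distD x X + M * G.dj X) +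
          (-κ' * G.dj X + -a' * Γ.distC x (Γ.pick x X))) :=
        mul_le_mul_of_nonneg_left (Real.exp_le_exp.2 key) hCE
    _ = CE * Real.exp (δ₁ * M * c₁) * Real.exp (-δ₁ * ρ x y) *
          Real.exp (-θ * (Γ.distD x X + M * G.dj X)) *
          (Real.exp (-κ' * G.dj X) * Real.exp (-a' * Γ.distC x (Γ.pick x X))) := by
        rw [Real.exp_add, Real.exp_add, Real.exp_add, Real.exp_add]; ring

/-- Regrouping a FINITE family of domains by a chosen cube of each domain (the (0.26) move *"Σ_{X∈𝐃_j} ≤ Σ_{□∈π_j}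
Σ_{X∈𝐃_j, X⊃□}"* with a site-dependent choice of the cube and a cube weight): for w ≥ 0 and a bound K on the f-sums
over finite families through any cube, Σ_{X∈F} f(X)·w(□(x,X)) ≤ K · Σ_{□ ∈ □(x,F)} w(□).  Finite combinatorics. [folklore] -/
theorem sum_pick_le (f : G.Dom → ℝ) (w : G.Cube → ℝ) (hw : ∀ c, 0 ≤ w c) {K : ℝ}
    (hK : ∀ (c : G.Cube) (F : Finset G.Dom), (∀ X ∈ F, c ∈ G.cubes X) → ∑ X ∈ F, f X ≤ K)
    (x : Λ) (F : Finset G.Dom) :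
    ∑ X ∈ F, f X * w (Γ.pick x X) ≤ K * ∑ c ∈ F.image (Γ.pick x), w c := by
  classical
  rw [← Finset.sum_fiberwise_of_maps_to (s := F) (t := F.image (Γ.pick x)) (g := Γ.pick x)
    (fun X hX => Finset.mem_image_of_mem _ hX) (fun X => f X * w (Γ.pick x X))]
  rw [Finset.mul_sum]
  refine Finset.sum_le_sum fun c _ => ?_
  calc ∑ X ∈ F.filter (fun X => Γ.pick x X = c), f X * w (Γ.pick x X)
      = ∑ X ∈ F.filter (fun X => Γ.pick x X = c), f X * w c :=
        Finset.sum_congr rfl fun X hX => by rw [(Finset.mem_filter.1 hX).2]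
    _ = (∑ X ∈ F.filter (fun X => Γ.pick x X = c), f X) * w c := (Finset.sum_mul _ _ _).symm
    _ ≤ K * w c := by
        refine mul_le_mul_of_nonneg_right (hK c _ fun X hX => ?_) (hw c)
        have h := (Finset.mem_filter.1 hX).2
        rw [← h]
        exact Γ.pick_mem x X

/-- The domain and cube sums over a FINITE family: Σ_{X∈F} e^{−κ′d_j(X)} e^{−a′dist(x,□(x,X))} ≤ K₀K₁ from (1.26) on
the infinite class at rate κ′ and the cube-sum leaf at rate a′. [folklore] -/
theorem weight_sum_le {κ' a' K₀ K₁ : ℝ} (hK₀ : 0 ≤ K₀) (hcube : Γ.CubeSumLeaf a' K₁)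
    (htree : G.Ineq126 κ' K₀) (x : Λ) (F : Finset G.Dom) :
    ∑ X ∈ F, Real.exp (-κ' * G.dj X) * Real.exp (-a' * Γ.distC x (Γ.pick x X)) ≤ K₀ * K₁ := by
  classical
  have h1 := Γ.sum_pick_le (fun X => Real.exp (-κ' * G.dj X))
    (fun c => Real.exp (-a' * Γ.distC x c)) (fun c => Real.exp_nonneg _) htree x F
  exact h1.trans (mul_le_mul_of_nonneg_left (hcube x _) hK₀)

/-- **The engine.**  Under the kernel bound, the geometry leaf, the cube-sum leaf at rate a′, (1.26) on the infinite
class at rate κ′, and the budget δ₁M + θM + κ′ ≤ κ, δ₁ + θ + a′ ≤ δ₀ (δ₁, θ, a′ ≥ 0): for every FINITE family F of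
domains each satisfying R ≤ dist(x, X) + M d_j(X),
Σ_{X∈F} ∣𝐄²(X, x, y)∣ ≤ C_E e^{δ₁Mc₁} K₀ K₁ · e^{−θR} · e^{−δ₁∣x − y∣}. [folklore] -/
theorem sum_abs_le_of_far {ρ : Λ → Λ → ℝ} {E2 : G.Dom → Λ → Λ → ℝ}
    {CE κ δ₀ δ₁ θ κ' a' M c₁ K₀ K₁ R : ℝ} (hCE : 0 ≤ CE) (hK₀ : 0 ≤ K₀)
    (hδ₁ : 0 ≤ δ₁) (hθ : 0 ≤ θ) (ha' : 0 ≤ a') (hκb : δ₁ * M + θ * M + κ' ≤ κ) (hδb : δ₁ + θ + a' ≤ δ₀)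
    (hE : Γ.KernelBound E2 CE κ δ₀) (hgeo : Γ.GeomLeaf ρ M c₁)
    (hcube : Γ.CubeSumLeaf a' K₁) (htree : G.Ineq126 κ' K₀) (x y : Λ) (F : Finset G.Dom)
    (hR : ∀ X ∈ F, R ≤ Γ.distD x X + M * G.dj X) :
    ∑ X ∈ F, |E2 X x y| ≤
      CE * Real.exp (δ₁ * M * c₁) * K₀ * K₁ * Real.exp (-θ * R) * Real.exp (-δ₁ * ρ x y) := by
  have hc : 0 ≤ CE * Real.exp (δ₁ * M * c₁) * Real.exp (-δ₁ * ρ x y) :=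
    mul_nonneg (mul_nonneg hCE (Real.exp_nonneg _)) (Real.exp_nonneg _)
  have hc' : 0 ≤ CE * Real.exp (δ₁ * M * c₁) * Real.exp (-δ₁ * ρ x y) * Real.exp (-θ * R) :=
    mul_nonneg hc (Real.exp_nonneg _)
  have step1 : ∀ X ∈ F, |E2 X x y| ≤
      CE * Real.exp (δ₁ * M * c₁) * Real.exp (-δ₁ * ρ x y) * Real.exp (-θ * R) *
        (Real.exp (-κ' * G.dj X) * Real.exp (-a' * Γ.distC x (Γ.pick x X))) := by
    intro X hX
    refine (hE X x y).trans ((Γ.term_le hCE hδ₁ hθ ha' hκb hδb hgeo X x y).trans ?_)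
    have hθR : Real.exp (-θ * (Γ.distD x X + M * G.dj X)) ≤ Real.exp (-θ * R) := by
      apply Real.exp_le_exp.2
      have := mul_le_mul_of_nonneg_left (hR X hX) hθ
      linarith
    exact mul_le_mul_of_nonneg_right (mul_le_mul_of_nonneg_left hθR hc)
      (mul_nonneg (Real.exp_nonneg _) (Real.exp_nonneg _))
  calc ∑ X ∈ F, |E2 X x y|
      ≤ ∑ X ∈ F, CE * Real.exp (δ₁ * M * c₁) * Real.exp (-δ₁ * ρ x y) * Real.exp (-θ * R) *
          (Real.exp (-κ' * G.dj X) * Real.exp (-a' * Γ.distC x (Γ.pick x X))) :=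
        Finset.sum_le_sum step1
    _ = CE * Real.exp (δ₁ * M * c₁) * Real.exp (-δ₁ * ρ x y) * Real.exp (-θ * R) *
          ∑ X ∈ F, Real.exp (-κ' * G.dj X) * Real.exp (-a' * Γ.distC x (Γ.pick x X)) :=
        (Finset.mul_sum _ _ _).symm
    _ ≤ CE * Real.exp (δ₁ * M * c₁) * Real.exp (-δ₁ * ρ x y) * Real.exp (-θ * R) * (K₀ * K₁) :=
        mul_le_mul_of_nonneg_left (Γ.weight_sum_le hK₀ hcube htree x F) hc'
    _ = CE * Real.exp (δ₁ * M * c₁) * K₀ * K₁ * Real.exp (-θ * R) * Real.exp (-δ₁ * ρ x y) := by ring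

/-- The engine without a separation condition (θ = 0, any finite family; M ≥ 0): Σ_{X∈F} ∣𝐄²(X, x, y)∣ ≤
C_E e^{δ₁Mc₁} K₀K₁ e^{−δ₁∣x − y∣} under δ₁M + κ′ ≤ κ, δ₁ + a′ ≤ δ₀ — `B12Decay510.sum_abs_le` over an arbitrary finite
subfamily of the infinite class. [cite: Balaban1987RG1, (5.10) p.293] -/
theorem sum_abs_le {ρ : Λ → Λ → ℝ} {E2 : G.Dom → Λ → Λ → ℝ}
    {CE κ δ₀ δ₁ κ' a' M c₁ K₀ K₁ : ℝ} (hCE : 0 ≤ CE) (hK₀ : 0 ≤ K₀) (hM : 0 ≤ M)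
    (hδ₁ : 0 ≤ δ₁) (ha' : 0 ≤ a') (hκb : δ₁ * M + κ' ≤ κ) (hδb : δ₁ + a' ≤ δ₀)
    (hE : Γ.KernelBound E2 CE κ δ₀) (hgeo : Γ.GeomLeaf ρ M c₁)
    (hcube : Γ.CubeSumLeaf a' K₁) (htree : G.Ineq126 κ' K₀) (x y : Λ) (F : Finset G.Dom) :
    ∑ X ∈ F, |E2 X x y| ≤ CE * Real.exp (δ₁ * M * c₁) * K₀ * K₁ * Real.exp (-δ₁ * ρ x y) := by
  have h := Γ.sum_abs_le_of_far (θ := 0) (R := 0) hCE hK₀ hδ₁ le_rfl ha' (by linarith) (by linarith)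
    hE hgeo hcube htree x y F
    (fun X _ => add_nonneg (Γ.distD_nonneg x X) (mul_nonneg hM (G.dj_nonneg X)))
  have h0 : Real.exp (-(0 : ℝ) * 0) = 1 := by simp
  rw [h0, mul_one] at h
  exact h

/-! ## 5. (4.36) and (4.37) on the infinite class: summability and the bounds on the infinite sums -/

/-- **(4.36), kernel-checked from the named leaves.**  For x ∈ □ (`x ∈ Box`), the family X ↦ 𝐄^{(2)}_{μν}(X, x, y)
over the INFINITE subclass {X ∈ 𝐃⁰_j : X∩(□̃²)ᶜ ≠ ∅} (`{X // Far X}`) is (absolutely) summable, and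
∣Σ_{X∈𝐃⁰_j, X∩(□̃²)ᶜ≠∅} 𝐄^{(2)}_{μν}(X, x, y)∣ ≤ C_E e^{δ₁Mc₁} K₀ K₁ · e^{−θR} · e^{−δ₁∣x − y∣} for every budget
δ₁M + θM + κ′ ≤ κ, δ₁ + θ + a′ ≤ δ₀ — *"exponentially small …, either because the domains are large, or because their
distances to □ are large"* (`FarLeaf`) times the decay in ∣x − y∣. [cite: Balaban1987RG1, (4.36) p.290] -/
theorem ineq436 {ρ : Λ → Λ → ℝ} {E2 : G.Dom → Λ → Λ → ℝ}
    {CE κ δ₀ δ₁ θ κ' a' M c₁ K₀ K₁ R : ℝ} {Far : G.Dom → Prop} {Box : Set Λ}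
    (hCE : 0 ≤ CE) (hK₀ : 0 ≤ K₀) (hδ₁ : 0 ≤ δ₁) (hθ : 0 ≤ θ) (ha' : 0 ≤ a')
    (hκb : δ₁ * M + θ * M + κ' ≤ κ) (hδb : δ₁ + θ + a' ≤ δ₀)
    (hE : Γ.KernelBound E2 CE κ δ₀) (hgeo : Γ.GeomLeaf ρ M c₁)
    (hcube : Γ.CubeSumLeaf a' K₁) (htree : G.Ineq126 κ' K₀) (hfar : Γ.FarLeaf Far Box M R)
    {x : Λ} (hx : x ∈ Box) (y : Λ) :
    Summable (fun X : {X : G.Dom // Far X} => E2 X.1 x y) ∧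
    |∑' X : {X : G.Dom // Far X}, E2 X.1 x y| ≤
      CE * Real.exp (δ₁ * M * c₁) * K₀ * K₁ * Real.exp (-θ * R) * Real.exp (-δ₁ * ρ x y) := by
  refine summable_and_abs_tsum_le_of_sum_abs_le (fun X : {X : G.Dom // Far X} => E2 X.1 x y) fun u => ?_
  have h := Γ.sum_abs_le_of_far hCE hK₀ hδ₁ hθ ha' hκb hδb hE hgeo hcube htree x y
    (u.map (Function.Embedding.subtype _)) (fun X hX => by
      obtain ⟨X', _, rfl⟩ := Finset.mem_map.1 hX
      exact hfar X'.1 x X'.2 hx)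
  simpa only [Finset.sum_map, Function.Embedding.coe_subtype] using h

/-- **(4.37) converges absolutely on 𝐃⁰_j, with the (5.10) bound** (θ = 0; M ≥ 0): the family X ↦ 𝐄^{(2)}_{μν}(X, x, y)
over the whole infinite class is summable and the vacuum polarization tensor Π_{μν}(x, y) = Σ_{X∈𝐃⁰_j} 𝐄^{(2)}_{μν}(X,
x, y) obeys ∣Π(x, y)∣ ≤ C_E e^{δ₁Mc₁} K₀ K₁ e^{−δ₁∣x − y∣} for every budget δ₁M + κ′ ≤ κ, δ₁ + a′ ≤ δ₀ — (5.10)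
p. 293 DIRECTLY on the infinite lattice (the absolute convergence of (4.37), used silently in print, included).
[cite: Balaban1987RG1, (4.37) p.291 and (5.10) p.293] -/
theorem twoPoint_summable {ρ : Λ → Λ → ℝ} {E2 : G.Dom → Λ → Λ → ℝ}
    {CE κ δ₀ δ₁ κ' a' M c₁ K₀ K₁ : ℝ} (hCE : 0 ≤ CE) (hK₀ : 0 ≤ K₀) (hM : 0 ≤ M)
    (hδ₁ : 0 ≤ δ₁) (ha' : 0 ≤ a') (hκb : δ₁ * M + κ' ≤ κ) (hδb : δ₁ + a' ≤ δ₀)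
    (hE : Γ.KernelBound E2 CE κ δ₀) (hgeo : Γ.GeomLeaf ρ M c₁)
    (hcube : Γ.CubeSumLeaf a' K₁) (htree : G.Ineq126 κ' K₀) (x y : Λ) :
    Summable (fun X : G.Dom => E2 X x y) ∧
    |∑' X, E2 X x y| ≤ CE * Real.exp (δ₁ * M * c₁) * K₀ * K₁ * Real.exp (-δ₁ * ρ x y) :=
  summable_and_abs_tsum_le_of_sum_abs_le (fun X => E2 X x y) fun u =>
    Γ.sum_abs_le hCE hK₀ hM hδ₁ ha' hκb hδb hE hgeo hcube htree x y u

/-! ## 6. The printed constants -/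

/-- The printed δ₁ = ½ min{δ₀, κM⁻¹} with θ = δ₁/2, κ′ = κ/4, a′ = δ₀/4 satisfies the budget (M > 0):
δ₁M ≤ κ/2 and δ₁ ≤ δ₀/2 (`B12Decay510.delta1_mul_le`, `delta1_le_half`). [cite: Balaban1987RG1, (5.10) p.293] -/
theorem budget_delta1 (δ₀ κ : ℝ) {M : ℝ} (hM : 0 < M) :
    delta1 δ₀ κ M * M + delta1 δ₀ κ M / 2 * M + κ / 4 ≤ κ ∧
      delta1 δ₀ κ M + delta1 δ₀ κ M / 2 + δ₀ / 4 ≤ δ₀ := by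
  have h1 := delta1_mul_le δ₀ κ hM
  have h2 := delta1_le_half δ₀ κ M
  constructor
  · linarith
  · linarith

/-- **(4.36) with the printed δ₁** = `delta1 δ₀ κ M` and the smallness rate θ = δ₁/2 (domain count at κ/4, cube sum at
δ₀/4): ∣Σ_{X : Far} 𝐄²(X, x, y)∣ ≤ C_E e^{δ₁Mc₁} K₀ K₁ · e^{−(δ₁/2)R} · e^{−δ₁∣x − y∣} for x ∈ □. [cite: Balaban1987RG1, (4.36) p.290] -/
theorem ineq436_delta1 {ρ : Λ → Λ → ℝ} {E2 : G.Dom → Λ → Λ → ℝ}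
    {CE κ δ₀ M c₁ K₀ K₁ R : ℝ} {Far : G.Dom → Prop} {Box : Set Λ}
    (hCE : 0 ≤ CE) (hK₀ : 0 ≤ K₀) (hδ₀ : 0 ≤ δ₀) (hκ : 0 ≤ κ) (hM : 0 < M)
    (hE : Γ.KernelBound E2 CE κ δ₀) (hgeo : Γ.GeomLeaf ρ M c₁)
    (hcube : Γ.CubeSumLeaf (δ₀ / 4) K₁) (htree : G.Ineq126 (κ / 4) K₀) (hfar : Γ.FarLeaf Far Box M R)
    {x : Λ} (hx : x ∈ Box) (y : Λ) :
    Summable (fun X : {X : G.Dom // Far X} => E2 X.1 x y) ∧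
    |∑' X : {X : G.Dom // Far X}, E2 X.1 x y| ≤
      CE * Real.exp (delta1 δ₀ κ M * M * c₁) * K₀ * K₁ * Real.exp (-(delta1 δ₀ κ M / 2) * R) *
        Real.exp (-(delta1 δ₀ κ M) * ρ x y) := by
  have hδ₁ := delta1_nonneg hδ₀ hκ hM
  obtain ⟨hb1, hb2⟩ := budget_delta1 δ₀ κ hM
  exact Γ.ineq436 hCE hK₀ hδ₁ (by linarith) (by linarith) hb1 hb2 hE hgeo hcube htree hfar hx y

/-- **(4.36) in the printed shape** «≤ O(1)E₀ exp(−(L^jη)^{−1}) exp(−δ₁∣x − y∣), for x ∈ □»: with T = (L^jη)^{−1},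
whenever T ≤ θR (θ = δ₁/2 = ¼ min{δ₀, κM⁻¹}; for the printed R = M·T this is min{δ₀M, κ} ≥ 4), the bound reads
∣Σ_{X : Far} 𝐄²(X, x, y)∣ ≤ (C_E e^{δ₁Mc₁} K₀ K₁) · e^{−T} · e^{−δ₁∣x − y∣}. [cite: Balaban1987RG1, (4.36) p.290] -/
theorem ineq436_printed {ρ : Λ → Λ → ℝ} {E2 : G.Dom → Λ → Λ → ℝ}
    {CE κ δ₀ M c₁ K₀ K₁ R T : ℝ} {Far : G.Dom → Prop} {Box : Set Λ}
    (hCE : 0 ≤ CE) (hK₀ : 0 ≤ K₀) (hδ₀ : 0 ≤ δ₀) (hκ : 0 ≤ κ) (hM : 0 < M)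
    (hE : Γ.KernelBound E2 CE κ δ₀) (hgeo : Γ.GeomLeaf ρ M c₁)
    (hcube : Γ.CubeSumLeaf (δ₀ / 4) K₁) (htree : G.Ineq126 (κ / 4) K₀) (hfar : Γ.FarLeaf Far Box M R)
    (hT : T ≤ delta1 δ₀ κ M / 2 * R) {x : Λ} (hx : x ∈ Box) (y : Λ) :
    |∑' X : {X : G.Dom // Far X}, E2 X.1 x y| ≤
      CE * Real.exp (delta1 δ₀ κ M * M * c₁) * K₀ * K₁ * Real.exp (-T) *
        Real.exp (-(delta1 δ₀ κ M) * ρ x y) := by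
  have h := (Γ.ineq436_delta1 hCE hK₀ hδ₀ hκ hM hE hgeo hcube htree hfar hx y).2
  refine h.trans ?_
  have hc : 0 ≤ CE * Real.exp (delta1 δ₀ κ M * M * c₁) * K₀ * K₁ :=
    mul_nonneg (mul_nonneg (mul_nonneg hCE (Real.exp_nonneg _)) hK₀) ?_
  · have hθ : Real.exp (-(delta1 δ₀ κ M / 2) * R) ≤ Real.exp (-T) := Real.exp_le_exp.2 (by linarith)
    exact mul_le_mul_of_nonneg_right (mul_le_mul_of_nonneg_left hθ hc) (Real.exp_nonneg _)
  · -- K₁ ≥ 0: the cube-sum leaf on the empty set of cubes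
    simpa using hcube x ∅

/-- **(4.36) with the domain count DISCHARGED** from the volume leaf and the degree bound (`ineq126_of_volumeLeaf` at
rate κ/4, i.e. κ ≥ 4κ₀(c₀, Δ); K₀ = K₀(c₀, Δ)): only the kernel bound, the geometry, cube-sum and separation leaves
remain as hypotheses. [cite: Balaban1987RG1, (4.36) p.290] -/
theorem ineq436_of_volumeLeaf {ρ : Λ → Λ → ℝ} {E2 : G.Dom → Λ → Λ → ℝ} {Δ : ℕ}
    {CE κ δ₀ M c₀ c₁ K₁ R : ℝ} {Far : G.Dom → Prop} {Box : Set Λ}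
    (hCE : 0 ≤ CE) (hδ₀ : 0 ≤ δ₀) (hκ : 0 ≤ κ) (hM : 0 < M)
    (hΔ : G.DegreeLE Δ) (hV : G.VolumeLeaf c₀) (hκ₀ : kappa₀ c₀ Δ ≤ κ / 4)
    (hE : Γ.KernelBound E2 CE κ δ₀) (hgeo : Γ.GeomLeaf ρ M c₁)
    (hcube : Γ.CubeSumLeaf (δ₀ / 4) K₁) (hfar : Γ.FarLeaf Far Box M R)
    {x : Λ} (hx : x ∈ Box) (y : Λ) :
    Summable (fun X : {X : G.Dom // Far X} => E2 X.1 x y) ∧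
    |∑' X : {X : G.Dom // Far X}, E2 X.1 x y| ≤
      CE * Real.exp (delta1 δ₀ κ M * M * c₁) * K₀ c₀ Δ * K₁ * Real.exp (-(delta1 δ₀ κ M / 2) * R) *
        Real.exp (-(delta1 δ₀ κ M) * ρ x y) :=
  Γ.ineq436_delta1 hCE (K₀_pos c₀ Δ).le hδ₀ hκ hM hE hgeo hcube (G.ineq126_of_volumeLeaf hΔ hV hκ₀) hfar hx y

/-- **(5.10) on the infinite class with the printed δ₁** = ½ min{δ₀, κM⁻¹} (domain count at κ/2, cube sum at δ₀/2, as
in `B12Decay510.abs_twoPoint_le_delta1`): (4.37) converges absolutely and ∣Π(x, y)∣ ≤ C_E e^{δ₁Mc₁} K₀ K₁ e^{−δ₁∣x − y∣}.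
[cite: Balaban1987RG1, (5.10) p.293] -/
theorem twoPoint_delta1 {ρ : Λ → Λ → ℝ} {E2 : G.Dom → Λ → Λ → ℝ}
    {CE κ δ₀ M c₁ K₀ K₁ : ℝ} (hCE : 0 ≤ CE) (hK₀ : 0 ≤ K₀) (hδ₀ : 0 ≤ δ₀) (hκ : 0 ≤ κ) (hM : 0 < M)
    (hE : Γ.KernelBound E2 CE κ δ₀) (hgeo : Γ.GeomLeaf ρ M c₁)
    (hcube : Γ.CubeSumLeaf (δ₀ / 2) K₁) (htree : G.Ineq126 (κ / 2) K₀) (x y : Λ) :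
    Summable (fun X : G.Dom => E2 X x y) ∧
    |∑' X, E2 X x y| ≤ CE * Real.exp (delta1 δ₀ κ M * M * c₁) * K₀ * K₁ *
      Real.exp (-(delta1 δ₀ κ M) * ρ x y) := by
  have h1 := delta1_mul_le δ₀ κ hM
  have h2 := delta1_le_half δ₀ κ M
  exact Γ.twoPoint_summable hCE hK₀ hM.le (delta1_nonneg hδ₀ hκ hM) (by linarith) (by linarith) (by linarith)
    hE hgeo hcube htree x y

/-- Landing in the lineage's typed (5.10): on the site lattice ℤ^d with ∣x − y∣ := ∣y − x∣₁ (`B12Sec2to5.l1`, the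
ℓ¹ reading of `B12Sec2to5.Decay510`), a two-point bound ∣Σ′_X 𝐄²(X, x, y)∣ ≤ C e^{−δ₁∣y − x∣₁} gives
`Decay510 (z ↦ Σ′_X 𝐄²(X, 0, z)) C δ₁`. [cite: Balaban1987RG1, (5.10) p.293] -/
theorem decay510_of_twoPoint {d : ℕ} {G : DomainClass} {E2 : G.Dom → (Fin d → ℤ) → (Fin d → ℤ) → ℝ}
    {C δ₁ : ℝ} (h : ∀ x y, |∑' X, E2 X x y| ≤ C * Real.exp (-δ₁ * l1 (y - x))) :
    Decay510 (fun z => ∑' X, E2 X 0 z) C δ₁ := by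
  intro z
  simpa using h 0 z

end SiteGeometry

/-! ## 7. Dictionary: the finite systems of `B12TreeDecay` / `B12Decay510` are the special case -/

/-- A finite `B12TreeDecay.CubeSystem` (domains of a torus) IS a `DomainClass`. [folklore] -/
abbrev DomainClass.ofCubeSystem {S : LocDomainSys} (Gc : B12TreeDecay.CubeSystem S) : DomainClass where
  Cube := Gc.Cube
  Adj := Gc.Adj
  adj_symm := Gc.adj_symm
  nbr := Gc.nbr
  mem_nbr := Gc.mem_nbr
  Dom := S.Dom
  cubes := Gc.cubes
  cubes_injective := Gc.cubes_injective
  connected := Gc.connected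
  dj := S.dj
  dj_nonneg := S.dj_nonneg

/-- On a finite system, (1.26) as a uniform finite-family bound ⟺ the printed full sum over {X ⊃ □}
(`B12TreeDecay.CubeSystem.Ineq126Printed`): the infinite-class typing is a conservative extension. [cite: Balaban1988RG2Cluster, (1.26) p.8] -/
theorem ineq126_iff_printed {S : LocDomainSys} (Gc : B12TreeDecay.CubeSystem S) (κ K : ℝ) :
    (DomainClass.ofCubeSystem Gc).Ineq126 κ K ↔ Gc.Ineq126Printed κ K := by
  constructor
  · intro h c
    exact h c (Gc.above c) (fun _ hX => (B12TreeDecay.CubeSystem.mem_above Gc).1 hX)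
  · intro h c F hF
    calc ∑ X ∈ F, Real.exp (-κ * S.dj X)
        ≤ ∑ X ∈ Gc.above c, Real.exp (-κ * S.dj X) :=
          Finset.sum_le_sum_of_subset_of_nonneg
            (fun X hX => (B12TreeDecay.CubeSystem.mem_above Gc).2 (hF X hX))
            (fun _ _ _ => Real.exp_nonneg _)
      _ ≤ K := h c

/-- (1.26) of the infinite-class typing gives the tree leaf of `B12Decay510` on a finite system. [cite: Balaban1988RG2Cluster, (1.26) p.8] -/
theorem treeLeaf_of_ineq126 {S : LocDomainSys} (Gc : B12TreeDecay.CubeSystem S) {κ K : ℝ}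
    (h : (DomainClass.ofCubeSystem Gc).Ineq126 κ K) : B12Decay510.TreeLeaf Gc.toCubeCover κ K :=
  fun c => h c (Gc.above c) (fun _ hX => (B12TreeDecay.CubeSystem.mem_above Gc).1 hX)

/-- A `B12Decay510.SiteGeometry` over the cover of a finite cube system IS a `SiteGeometry` of the corresponding
`DomainClass`. [folklore] -/
def SiteGeometry.ofFinite {S : LocDomainSys} (Gc : B12TreeDecay.CubeSystem S) {Λ : Type*}
    (Gs : B12Decay510.SiteGeometry Gc.toCubeCover Λ) : SiteGeometry (DomainClass.ofCubeSystem Gc) Λ where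
  distC := Gs.distC
  distD := Gs.distD
  distC_nonneg := Gs.distC_nonneg
  distD_nonneg := Gs.distD_nonneg
  pick := Gs.pick
  pick_mem := fun x X => (B12TreeDecay.CubeSystem.mem_above Gc).1 (Gs.pick_mem x X)
  distC_pick_le := Gs.distC_pick_le

/-- **`B12Decay510.sum_abs_le` recovered** (for M ≥ 0) from the infinite-class engine on the finite special case: under
`B12Decay510`'s hypotheses (kernel bound, geometry leaf, cube-sum leaf at δ₀/2, tree leaf at κ/2, 0 ≤ δ₁ ≤ δ₀/2,
δ₁M ≤ κ/2), Σ_{X∈𝐃_j} ∣𝐄²(X, x, y)∣ ≤ C_E e^{δ₁Mc₁} K₀ K₁ e^{−δ₁∣x − y∣}. [cite: Balaban1987RG1, (5.10) p.293] -/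
theorem sum_abs_le_ofFinite {S : LocDomainSys} (Gc : B12TreeDecay.CubeSystem S) {Λ : Type*}
    (Gs : B12Decay510.SiteGeometry Gc.toCubeCover Λ) {ρ : Λ → Λ → ℝ} {E2 : S.Dom → Λ → Λ → ℝ}
    {CE κ δ₀ δ₁ M c₁ K₀ K₁ : ℝ} (hCE : 0 ≤ CE) (hK₀ : 0 ≤ K₀) (hM : 0 ≤ M)
    (hδ₁ : 0 ≤ δ₁) (hδ₁δ₀ : δ₁ ≤ δ₀ / 2) (hδ₁κ : δ₁ * M ≤ κ / 2)
    (hE : B12Decay510.KernelBound Gs E2 CE κ δ₀) (hgeo : B12Decay510.GeomLeaf Gs ρ M c₁)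
    (hcube : B12Decay510.CubeSumLeaf Gs (δ₀ / 2) K₁) (htree : B12Decay510.TreeLeaf Gc.toCubeCover (κ / 2) K₀)
    (x y : Λ) :
    ∑ X, |E2 X x y| ≤ CE * Real.exp (δ₁ * M * c₁) * K₀ * K₁ * Real.exp (-δ₁ * ρ x y) := by
  have hcube' : (SiteGeometry.ofFinite Gc Gs).CubeSumLeaf (δ₀ / 2) K₁ := fun x B =>
    (Finset.sum_le_sum_of_subset_of_nonneg (Finset.subset_univ B) (fun _ _ _ => Real.exp_nonneg _)).trans
      (hcube x)
  have htree' : (DomainClass.ofCubeSystem Gc).Ineq126 (κ / 2) K₀ := (ineq126_iff_printed Gc _ _).2 htree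
  exact (SiteGeometry.ofFinite Gc Gs).sum_abs_le (κ' := κ / 2) (a' := δ₀ / 2) hCE hK₀ hM hδ₁ (by linarith)
    (by linarith) (by linarith) hE hgeo hcube' htree' x y Finset.univ

end Literature.MathematicalPhysics.QuantumFieldTheory.Balaban1983to89.B12Ext436
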